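import Mathlib
import HarnessLib

/-!
# The Bombieri–Giusti / Moser abstract lemma (Harnack inequalities without John–Nirenberg)

Topic `Analysis/FunctionSpaces`.  Moser's 1971 device (J. Moser, *On a pointwise estimate for parabolic differential
equations*, CPAM 24 (1971), Lemma 3; E. Bombieri – E. Giusti 1972; L. Saloff-Coste, *Aspects of Sobolev-type
inequalities* (2002), Lemma 2.2.6): let `S θ`, `½ ≤ θ ≤ 1`, be an increasing family of measurable sets of a measure
space (think: concentric balls `B̄(x₀, θR)`), `f > 0` a measurable function, bounded on `S 1`, such that

* (A) **weak-`L¹` logarithm**: `μ{x ∈ S 1 : log f(x) > t} ≤ (C₀/t) μ(S 1)` for all `t > 0`;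
* (B) **`L^p → L^∞` bounds with blow-up, on a log-dense set of exponents**: for `½ ≤ θ' < θ ≤ 1` and
  `0 < p ≤ p̄` there is `p' ∈ [p/κ₀, p]` with `sup_{S θ'} f^{p'} ≤ (C₁/(θ−θ')^γ) · μ(S 1)⁻¹ ∫_{S θ} f^{p'}`
  (`κ₀ ≥ 1`; `κ₀ = 1` is the textbook hypothesis "for all `p`"; the freedom `p' ∈ [p/κ₀, p]` is what a Moser
  iteration delivers, whose admissible exponents avoid a discrete set).

Then `sup_{S ½} f ≤ A` with `A` depending only on `C₀, C₁, γ, κ₀, p̄` — here, explicitly,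
`log A = 4 C₀ (2C₁)^{2κ₀} 4^{γκ₀} (16γκ₀)^{4γκ₀}` once `C₀ ≥ 1/p̄`, `C₁ ≥ 1`, `γ > 0` (enlarging the constants of
(A), (B) is free).
This replaces the `BMO`/John–Nirenberg "crossover" in Moser's 1961 proof of the Harnack inequality and, unlike it,
uses only sub-balls of ONE ball — which is what a LOCAL weak solution provides.

* `bombieriGiusti_step` — the dichotomy behind the lemma: if `log f ≤ Φ` on `S θ` and
  `Φ > 2C₀(2C₁/(θ−θ')^γ)^{2κ₀}`, then `log f ≤ ¾Φ` on `S θ'` (test (B) with the exponent `p = 2 log(Φ/2C₀)/Φ`, at the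
  admissible `p' ∈ [p/κ₀, p]`, and split `∫ f^{p'}` at `log f = Φ/2`);
* `rpow_mul_pow_le` (private) — the elementary bound `(k+2)^m (3/4)^k ≤ 2 (4m)^m`;
* `bombieriGiusti` — the lemma, by running the dichotomy along `θ_k = 1 − 1/(2(k+1))`.

## References
* J. Moser, *On a pointwise estimate for parabolic differential equations*, Comm. Pure Appl. Math. 24 (1971) 727–740,
  Lemma 3. [Moser1971Pointwise]
* L. Saloff-Coste, *Aspects of Sobolev-Type Inequalities*, LMS Lecture Note Series 289, CUP (2002), Lemma 2.2.6.
  [SaloffCoste2002]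
-/

noncomputable section

open MeasureTheory Set
open scoped ENNReal

namespace Literature.Analysis.FunctionSpaces

variable {α : Type*} [MeasurableSpace α] {μ : Measure α}

/-- **The dichotomy step of the Bombieri–Giusti / Moser lemma** (Moser 1971, proof of Lemma 3; Saloff-Coste 2002,
proof of Lemma 2.2.6): under (A) and (B) of the module docstring (with `C₀ p̄ ≥ 1`, `C₁ ≥ 1`, `γ ≥ 0`, `κ₀ ≥ 1`),
if `log f ≤ Φ` on `S θ` and `Φ > 2C₀ (2C₁/(θ−θ')^γ)^{2κ₀}`, then `log f ≤ ¾ Φ` on `S θ'`.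
[cite: Moser1971Pointwise, Lemma 3 (proof)] -/
theorem bombieriGiusti_step {S : ℝ → Set α} (hS : ∀ ⦃θ' θ : ℝ⦄, θ' ≤ θ → S θ' ⊆ S θ)
    (hSm : ∀ θ, MeasurableSet (S θ)) (hV0 : μ (S 1) ≠ 0) (hVt : μ (S 1) ≠ ∞)
    {f : α → ℝ} (hf : Measurable f) (hfpos : ∀ x ∈ S 1, 0 < f x)
    {C₀ C₁ γ pbar κ₀ : ℝ} (hC₀ : 0 < C₀) (hC₀p : 1 ≤ C₀ * pbar) (hC₁ : 1 ≤ C₁) (hγ : 0 ≤ γ) (hκ₀ : 1 ≤ κ₀)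
    (hA : ∀ t : ℝ, 0 < t → μ {x ∈ S 1 | t < Real.log (f x)} ≤ ENNReal.ofReal (C₀ / t) * μ (S 1))
    (hB : ∀ (θ' θ p : ℝ), 1 / 2 ≤ θ' → θ' < θ → θ ≤ 1 → 0 < p → p ≤ pbar → ∃ p' : ℝ, p / κ₀ ≤ p' ∧ p' ≤ p ∧
      ∀ x ∈ S θ', ENNReal.ofReal (f x ^ p') ≤
        ENNReal.ofReal (C₁ / (θ - θ') ^ γ) * (μ (S 1))⁻¹ * ∫⁻ y in S θ, ENNReal.ofReal (f y ^ p') ∂μ)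
    {θ' θ Φ : ℝ} (hθ' : 1 / 2 ≤ θ') (hθ'θ : θ' < θ) (hθ : θ ≤ 1)
    (hΦ : ∀ x ∈ S θ, Real.log (f x) ≤ Φ) (hlarge : 2 * C₀ * (2 * C₁ / (θ - θ') ^ γ) ^ (2 * κ₀) < Φ) :
    ∀ x ∈ S θ', Real.log (f x) ≤ 3 / 4 * Φ := by
  intro x hx
  -- the geometry constant `K₁ = 2C₁/δ^γ ≥ 2`
  set δ : ℝ := θ - θ' with hδ
  have hδpos : 0 < δ := by rw [hδ]; linarith
  have hδ1 : δ ≤ 1 := by rw [hδ]; linarith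
  have hδγ : 0 < δ ^ γ := Real.rpow_pos_of_pos hδpos γ
  have hδγ1 : δ ^ γ ≤ 1 := Real.rpow_le_one hδpos.le hδ1 hγ
  set K₁ : ℝ := 2 * C₁ / δ ^ γ with hK₁
  have hK₁2 : 2 ≤ K₁ := by
    rw [hK₁, le_div_iff₀ hδγ]; nlinarith
  have hK₁pos : 0 < K₁ := by linarith
  have hκ₀pos : 0 < κ₀ := by linarith
  -- `y = Φ/(2C₀) > K₁^{2κ₀} ≥ K₁² ≥ 4`
  set y : ℝ := Φ / (2 * C₀) with hy
  have hK₁y : K₁ ^ (2 * κ₀) < y := by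
    rw [hy, lt_div_iff₀ (by positivity)]; linarith
  have hK₁sq : K₁ ^ 2 ≤ K₁ ^ (2 * κ₀) := by
    rw [← Real.rpow_natCast K₁ 2]
    exact Real.rpow_le_rpow_of_exponent_le (by linarith) (by push_cast; linarith)
  have hy4 : 4 ≤ y := by nlinarith
  have hy1 : 1 < y := by linarith
  have hypos : 0 < y := by linarith
  have hlogy : 0 < Real.log y := Real.log_pos hy1
  have hΦy : Φ = 2 * C₀ * y := by rw [hy]; field_simp
  have hΦpos : 0 < Φ := by rw [hΦy]; positivity
  -- the exponent `p = 2 log y / Φ ∈ (0, p̄]` and the admissible `p' ∈ [p/κ₀, p]`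
  set p : ℝ := 2 * Real.log y / Φ with hp
  have hppos : 0 < p := by rw [hp]; positivity
  have hple : p ≤ pbar := by
    have h1 : Real.log y ≤ y - 1 := Real.log_le_sub_one_of_pos hypos
    have h2 : p ≤ 1 / C₀ := by
      rw [hp, hΦy, div_le_div_iff₀ (by positivity) hC₀]
      nlinarith
    have h3 : 1 / C₀ ≤ pbar := by rw [div_le_iff₀ hC₀]; linarith
    exact h2.trans h3
  obtain ⟨p', hp'lo, hp'hi, hBx⟩ := hB θ' θ p hθ' hθ'θ hθ hppos hple
  have hp'pos : 0 < p' := lt_of_lt_of_le (div_pos hppos hκ₀pos) hp'lo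
  have hpΦ : p * Φ / 2 = Real.log y := by rw [hp]; field_simp
  -- `y' = e^{p'Φ/2} ≤ y`
  set y' : ℝ := Real.exp (p' * (Φ / 2)) with hy'
  have hy'pos : 0 < y' := Real.exp_pos _
  have hy'le : y' ≤ y := by
    rw [hy', ← Real.exp_log hypos, ← hpΦ]
    exact Real.exp_le_exp.2 (by nlinarith)
  have hexp2 : Real.exp (p' * Φ) = y' ^ 2 := by
    rw [hy', sq, ← Real.exp_add]; ring_nf
  -- the super-level set at height `Φ/2`
  set T : Set α := {z ∈ S 1 | Φ / 2 < Real.log (f z)} with hT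
  have hTm : MeasurableSet T :=
    (hSm 1).inter (measurableSet_lt measurable_const hf.log)
  have hTμ : μ T ≤ ENNReal.ofReal (1 / y) * μ (S 1) := by
    have h := hA (Φ / 2) (by positivity)
    refine h.trans (le_of_eq ?_)
    congr 2
    rw [hΦy]; field_simp
  -- pointwise split of `f^{p'}` on `S θ`
  have hSθ1 : S θ ⊆ S 1 := hS hθ
  have hpt : ∀ z ∈ S θ, ENNReal.ofReal (f z ^ p') ≤
      ENNReal.ofReal y' + T.indicator (fun _ => ENNReal.ofReal (y' ^ 2)) z := by
    intro z hz
    have hfz : 0 < f z := hfpos z (hSθ1 hz)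
    have hrp : f z ^ p' = Real.exp (p' * Real.log (f z)) := by
      rw [Real.rpow_def_of_pos hfz, mul_comm]
    by_cases hcase : Φ / 2 < Real.log (f z)
    · have hzT : z ∈ T := ⟨hSθ1 hz, hcase⟩
      rw [indicator_of_mem hzT]
      refine le_add_left ?_
      refine ENNReal.ofReal_le_ofReal ?_
      rw [hrp, ← hexp2]
      exact Real.exp_le_exp.2 (mul_le_mul_of_nonneg_left (hΦ z hz) hp'pos.le)
    · rw [not_lt] at hcase
      refine le_add_right ?_
      refine ENNReal.ofReal_le_ofReal ?_
      rw [hrp, hy']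
      exact Real.exp_le_exp.2 (mul_le_mul_of_nonneg_left hcase hp'pos.le)
  -- integrate over `S θ`
  have hint : ∫⁻ z in S θ, ENNReal.ofReal (f z ^ p') ∂μ ≤ ENNReal.ofReal (2 * y') * μ (S 1) := by
    calc ∫⁻ z in S θ, ENNReal.ofReal (f z ^ p') ∂μ
        ≤ ∫⁻ z in S θ, ENNReal.ofReal y' + T.indicator (fun _ => ENNReal.ofReal (y' ^ 2)) z ∂μ :=
          setLIntegral_mono' (hSm θ) fun z hz => hpt z hz
      _ = ENNReal.ofReal y' * μ (S θ) + ∫⁻ z in S θ, T.indicator (fun _ => ENNReal.ofReal (y' ^ 2)) z ∂μ := by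
          rw [lintegral_add_left measurable_const, lintegral_const, Measure.restrict_apply_univ]
      _ ≤ ENNReal.ofReal y' * μ (S 1) + ∫⁻ z, T.indicator (fun _ => ENNReal.ofReal (y' ^ 2)) z ∂μ :=
          add_le_add (mul_le_mul' le_rfl (measure_mono hSθ1)) (lintegral_mono' Measure.restrict_le_self le_rfl)
      _ = ENNReal.ofReal y' * μ (S 1) + ENNReal.ofReal (y' ^ 2) * μ T := by
          rw [lintegral_indicator_const hTm]
      _ ≤ ENNReal.ofReal y' * μ (S 1) + ENNReal.ofReal (y' ^ 2) * (ENNReal.ofReal (1 / y) * μ (S 1)) := by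
          gcongr
      _ = (ENNReal.ofReal y' + ENNReal.ofReal (y' ^ 2 * (1 / y))) * μ (S 1) := by
          rw [← mul_assoc, ← ENNReal.ofReal_mul (by positivity), ← add_mul]
      _ ≤ ENNReal.ofReal (2 * y') * μ (S 1) := by
          refine mul_le_mul' ?_ le_rfl
          rw [← ENNReal.ofReal_add hy'pos.le (by positivity)]
          refine ENNReal.ofReal_le_ofReal ?_
          have h1 : y' ^ 2 * (1 / y) ≤ y' := by
            rw [← mul_div_assoc, mul_one, div_le_iff₀ hypos, sq]
            exact mul_le_mul_of_nonneg_left hy'le hy'pos.le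
          linarith
  -- hypothesis (B) at `x`
  have hfx : 0 < f x := hfpos x (hS (hθ'θ.le.trans hθ) hx)
  have hle : ENNReal.ofReal (f x ^ p') ≤ ENNReal.ofReal (K₁ * y') := by
    refine (hBx x hx).trans ?_
    calc ENNReal.ofReal (C₁ / (θ - θ') ^ γ) * (μ (S 1))⁻¹ * ∫⁻ z in S θ, ENNReal.ofReal (f z ^ p') ∂μ
        ≤ ENNReal.ofReal (C₁ / (θ - θ') ^ γ) * (μ (S 1))⁻¹ * (ENNReal.ofReal (2 * y') * μ (S 1)) :=
          mul_le_mul' le_rfl hint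
      _ = ENNReal.ofReal (C₁ / (θ - θ') ^ γ) * ENNReal.ofReal (2 * y') * ((μ (S 1))⁻¹ * μ (S 1)) := by ring
      _ = ENNReal.ofReal (K₁ * y') := by
          rw [ENNReal.inv_mul_cancel hV0 hVt, mul_one, ← ENNReal.ofReal_mul (by positivity), hK₁, hδ]
          ring_nf
  have hle' : f x ^ p' ≤ K₁ * y' := (ENNReal.ofReal_le_ofReal_iff (by positivity)).1 hle
  -- logarithms: `p' log f ≤ log K₁ + p'Φ/2`
  have hrpx : 0 < f x ^ p' := Real.rpow_pos_of_pos hfx p'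
  have hlog1 : p' * Real.log (f x) ≤ Real.log K₁ + p' * (Φ / 2) := by
    rw [← Real.log_rpow hfx, show p' * (Φ / 2) = Real.log y' by rw [hy', Real.log_exp],
      ← Real.log_mul hK₁pos.ne' hy'pos.ne']
    exact Real.log_le_log hrpx hle'
  -- `log K₁ ≤ log y/(2κ₀)` and `1/p' ≤ κ₀/p`, so `log K₁/p' ≤ κ₀ log K₁/p ≤ Φ/4`
  have hlogK₁ : 0 ≤ Real.log K₁ := Real.log_nonneg (by linarith)
  have hlog2 : 2 * κ₀ * Real.log K₁ < Real.log y := by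
    rw [← Real.log_rpow hK₁pos]
    exact Real.log_lt_log (Real.rpow_pos_of_pos hK₁pos _) hK₁y
  have hdiv : Real.log K₁ / p' ≤ κ₀ * Real.log K₁ / p := by
    rw [div_le_div_iff₀ hp'pos hppos]
    have : Real.log K₁ * p ≤ Real.log K₁ * (κ₀ * p') :=
      mul_le_mul_of_nonneg_left (by rw [div_le_iff₀ hκ₀pos] at hp'lo; linarith) hlogK₁
    linarith
  have hq : κ₀ * Real.log K₁ / p ≤ Φ / 4 := by
    rw [hp, div_le_iff₀ hppos] at *
    · -- `κ₀ log K₁ ≤ Φ/4 · (2 log y/Φ) = log y / 2`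
      have : Φ / 4 * (2 * Real.log y / Φ) = Real.log y / 2 := by field_simp; ring
      rw [this]; linarith
  have hfin : Real.log (f x) ≤ Real.log K₁ / p' + Φ / 2 := by
    rw [div_add' _ _ _ hp'pos.ne', le_div_iff₀ hp'pos]; linarith
  linarith

/-- An elementary bound used to sum the Bombieri–Giusti iteration: for `m > 0` and every `k : ℕ`,
`(k+2)^m (3/4)^k ≤ 2 (16 (m/4))^m = 2 (4m)^m`. [folklore] -/
private theorem rpow_mul_pow_le {m : ℝ} (hm : 0 < m) (k : ℕ) :
    ((k : ℝ) + 2) ^ m * (3 / 4 : ℝ) ^ k ≤ 2 * (4 * m) ^ m := by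
  set r : ℝ := Real.log (4 / 3) with hr
  have hr0 : 0 < r := Real.log_pos (by norm_num)
  have hr4 : 1 / 4 ≤ r := by
    -- `log (4/3) ≥ 1 - 3/4`
    have h := Real.one_sub_inv_le_log_of_pos (show (0:ℝ) < 4 / 3 by norm_num)
    rw [hr]; linarith [show (1 : ℝ) - (4 / 3)⁻¹ = 1 / 4 by norm_num]
  set x : ℝ := (k : ℝ) + 2 with hx
  have hxpos : 0 < x := by rw [hx]; positivity
  -- `x^m ≤ (m/r)^m e^{rx}` from `t ≤ e^t`, `t = rx/m`
  have hkey : x ^ m ≤ (m / r) ^ m * Real.exp (r * x) := by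
    set t : ℝ := r * x / m with ht
    have htpos : 0 < t := by rw [ht]; positivity
    have h1 : t ≤ Real.exp t := by linarith [Real.add_one_le_exp t]
    have h2 : t ^ m ≤ Real.exp t ^ m := Real.rpow_le_rpow htpos.le h1 hm.le
    have h3 : Real.exp t ^ m = Real.exp (r * x) := by
      rw [← Real.exp_mul, ht]; congr 1; field_simp
    have h4 : t ^ m = x ^ m / (m / r) ^ m := by
      rw [ht, show r * x / m = x / (m / r) by field_simp, Real.div_rpow hxpos.le (by positivity)]
    rw [h4, h3, div_le_iff₀ (Real.rpow_pos_of_pos (by positivity) m)] at h2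
    linarith [mul_comm ((m / r) ^ m) (Real.exp (r * x))]
  -- `(3/4)^k = e^{-r x} · (4/3)^2`
  have hpow : (3 / 4 : ℝ) ^ k = Real.exp (-(r * x)) * (16 / 9) := by
    have h34 : Real.exp (-r) = 3 / 4 := by
      rw [hr, Real.exp_neg, Real.exp_log (by norm_num)]; norm_num
    have h1 : Real.exp (-(r * x)) = (3 / 4 : ℝ) ^ (k + 2) := by
      rw [hx, show -(r * ((k : ℝ) + 2)) = ((k + 2 : ℕ) : ℝ) * (-r) by push_cast; ring, Real.exp_nat_mul, h34]
    rw [h1, pow_succ, pow_succ]; ring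
  -- `(m/r)^m ≤ (4m)^m`
  have hmr : (m / r) ^ m ≤ (4 * m) ^ m := by
    refine Real.rpow_le_rpow (by positivity) ?_ hm.le
    rw [div_le_iff₀ hr0]; nlinarith
  calc x ^ m * (3 / 4 : ℝ) ^ k ≤ (m / r) ^ m * Real.exp (r * x) * (3 / 4 : ℝ) ^ k :=
        mul_le_mul_of_nonneg_right hkey (by positivity)
    _ = (m / r) ^ m * (16 / 9) := by
        rw [hpow, mul_assoc, ← mul_assoc (Real.exp (r * x)), ← Real.exp_add, add_neg_cancel, Real.exp_zero, one_mul]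
    _ ≤ (4 * m) ^ m * 2 := mul_le_mul hmr (by norm_num) (by norm_num) (by positivity)
    _ = 2 * (4 * m) ^ m := mul_comm _ _

/-- **The Bombieri–Giusti / Moser abstract lemma** (Moser 1971, Lemma 3; Bombieri–Giusti 1972; Saloff-Coste 2002,
Lemma 2.2.6).  Let `S θ` be increasing measurable sets with `0 < μ(S 1) < ∞`, `f > 0` measurable on `S 1` with
`log f ≤ L` there (qualitative boundedness — `L` does not enter the bound), and suppose, with constants
`C₀ ≥ 1/p̄`, `C₁ ≥ 1`, `γ > 0`, `κ₀ ≥ 1`: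
(A) `μ{x ∈ S 1 : t < log f x} ≤ (C₀/t) μ(S 1)` for all `t > 0`;
(B) for `½ ≤ θ' < θ ≤ 1`, `0 < p ≤ p̄` some `p' ∈ [p/κ₀, p]` has `f(x)^{p'} ≤ (C₁/(θ−θ')^γ) μ(S 1)⁻¹ ∫_{S θ} f^{p'}`
for all `x ∈ S θ'`.
Then `log f ≤ 4 C₀ (2C₁)^{2κ₀} 4^{γκ₀} (16γκ₀)^{4γκ₀}` on `S ½`. [cite: Moser1971Pointwise, Lemma 3] -/
theorem bombieriGiusti {S : ℝ → Set α} (hS : ∀ ⦃θ' θ : ℝ⦄, θ' ≤ θ → S θ' ⊆ S θ)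
    (hSm : ∀ θ, MeasurableSet (S θ)) (hV0 : μ (S 1) ≠ 0) (hVt : μ (S 1) ≠ ∞)
    {f : α → ℝ} (hf : Measurable f) (hfpos : ∀ x ∈ S 1, 0 < f x) {L : ℝ} (hL : ∀ x ∈ S 1, Real.log (f x) ≤ L)
    {C₀ C₁ γ pbar κ₀ : ℝ} (hC₀ : 0 < C₀) (hC₀p : 1 ≤ C₀ * pbar) (hC₁ : 1 ≤ C₁) (hγ : 0 < γ) (hκ₀ : 1 ≤ κ₀)
    (hA : ∀ t : ℝ, 0 < t → μ {x ∈ S 1 | t < Real.log (f x)} ≤ ENNReal.ofReal (C₀ / t) * μ (S 1))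
    (hB : ∀ (θ' θ p : ℝ), 1 / 2 ≤ θ' → θ' < θ → θ ≤ 1 → 0 < p → p ≤ pbar → ∃ p' : ℝ, p / κ₀ ≤ p' ∧ p' ≤ p ∧
      ∀ x ∈ S θ', ENNReal.ofReal (f x ^ p') ≤
        ENNReal.ofReal (C₁ / (θ - θ') ^ γ) * (μ (S 1))⁻¹ * ∫⁻ y in S θ, ENNReal.ofReal (f y ^ p') ∂μ) :
    ∀ x ∈ S (1 / 2), Real.log (f x) ≤
      4 * C₀ * (2 * C₁) ^ (2 * κ₀) * 4 ^ (γ * κ₀) * (16 * (γ * κ₀)) ^ (4 * (γ * κ₀)) := by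
  -- the bound `A₀` and the radii `θ_k = 1 - 1/(2(k+1))`
  set A₀ : ℝ := 4 * C₀ * (2 * C₁) ^ (2 * κ₀) * 4 ^ (γ * κ₀) * (16 * (γ * κ₀)) ^ (4 * (γ * κ₀)) with hA₀
  have hκ₀pos : 0 < κ₀ := by linarith
  have hγ' : 0 < γ * κ₀ := by positivity
  have hA₀pos : 0 < A₀ := by rw [hA₀]; positivity
  set θs : ℕ → ℝ := fun k => 1 - 1 / (2 * ((k : ℝ) + 1)) with hθs
  have hθ0 : θs 0 = 1 / 2 := by simp only [hθs]; norm_num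
  have hθhalf : ∀ k, 1 / 2 ≤ θs k := fun k => by
    simp only [hθs]
    have hk : (0 : ℝ) ≤ k := Nat.cast_nonneg k
    have h1 : 1 / (2 * ((k : ℝ) + 1)) ≤ 1 / 2 := by
      rw [div_le_div_iff₀ (by positivity) (by norm_num)]; linarith
    linarith
  have hθle1 : ∀ k, θs k ≤ 1 := fun k => by
    simp only [hθs]
    have : 0 < 1 / (2 * ((k : ℝ) + 1)) := by positivity
    linarith
  have hθlt : ∀ k, θs k < θs (k + 1) := fun k => by
    simp only [hθs]
    push_cast
    have h1 : 0 < 2 * ((k : ℝ) + 1) := by positivity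
    have h2 : 1 / (2 * ((k : ℝ) + 1 + 1)) < 1 / (2 * ((k : ℝ) + 1)) :=
      one_div_lt_one_div_of_lt h1 (by linarith)
    linarith
  have hδ : ∀ k, θs (k + 1) - θs k = 1 / (2 * ((k : ℝ) + 1) * ((k : ℝ) + 2)) := fun k => by
    simp only [hθs]; push_cast; field_simp; ring
  -- the key summability bound: `(3/4)^k · M₁(δ_k) ≤ A₀`, i.e. `M₁(δ_k) ≤ (4/3)^k A₀`
  have hM₁ : ∀ k : ℕ, 2 * C₀ * (2 * C₁ / (θs (k + 1) - θs k) ^ γ) ^ (2 * κ₀) ≤ (4 / 3 : ℝ) ^ k * A₀ := by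
    intro k
    rw [hδ k]
    set d : ℝ := 1 / (2 * ((k : ℝ) + 1) * ((k : ℝ) + 2)) with hd
    have hk2 : 0 < ((k : ℝ) + 2) := by positivity
    have hdpos : 0 < d := by rw [hd]; positivity
    -- `1/d = 2(k+1)(k+2) ≤ 2(k+2)²`
    have hinv : d⁻¹ ≤ 2 * ((k : ℝ) + 2) ^ 2 := by
      rw [hd, one_div, inv_inv]; nlinarith
    -- `(2C₁/d^γ)^{2κ₀} = (2C₁)^{2κ₀} (d⁻¹)^{2γκ₀}`
    have hsq : (2 * C₁ / d ^ γ) ^ (2 * κ₀) = (2 * C₁) ^ (2 * κ₀) * (d⁻¹) ^ (2 * (γ * κ₀)) := by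
      rw [Real.div_rpow (by positivity) (Real.rpow_nonneg hdpos.le _), ← Real.rpow_mul hdpos.le,
        Real.inv_rpow hdpos.le, div_eq_mul_inv, show γ * (2 * κ₀) = 2 * (γ * κ₀) by ring]
    rw [hsq]
    have hb : (d⁻¹) ^ (2 * (γ * κ₀)) ≤ (2 * ((k : ℝ) + 2) ^ 2) ^ (2 * (γ * κ₀)) :=
      Real.rpow_le_rpow (by positivity) hinv (by positivity)
    have hc : (2 * ((k : ℝ) + 2) ^ 2) ^ (2 * (γ * κ₀)) = 4 ^ (γ * κ₀) * ((k : ℝ) + 2) ^ (4 * (γ * κ₀)) := by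
      rw [Real.mul_rpow (by norm_num) (by positivity), ← Real.rpow_natCast ((k : ℝ) + 2) 2,
        ← Real.rpow_mul hk2.le, show (2 : ℝ) ^ (2 * (γ * κ₀)) = 4 ^ (γ * κ₀) by
          rw [Real.rpow_mul (by norm_num), show (2 : ℝ) ^ (2 : ℝ) = 4 by norm_num]]
      push_cast; ring_nf
    have hd' := rpow_mul_pow_le (m := 4 * (γ * κ₀)) (by positivity) k
    -- `(k+2)^{4γκ₀} ≤ 2 (16γκ₀)^{4γκ₀} (4/3)^k`
    have he : ((k : ℝ) + 2) ^ (4 * (γ * κ₀)) ≤ 2 * (16 * (γ * κ₀)) ^ (4 * (γ * κ₀)) * (4 / 3 : ℝ) ^ k := by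
      rw [show (4 : ℝ) * (4 * (γ * κ₀)) = 16 * (γ * κ₀) by ring] at hd'
      have : ((k : ℝ) + 2) ^ (4 * (γ * κ₀)) =
          ((k : ℝ) + 2) ^ (4 * (γ * κ₀)) * (3 / 4 : ℝ) ^ k * (4 / 3 : ℝ) ^ k := by
        rw [mul_assoc, ← mul_pow]; norm_num
      rw [this]
      exact mul_le_mul_of_nonneg_right hd' (by positivity)
    calc 2 * C₀ * ((2 * C₁) ^ (2 * κ₀) * (d⁻¹) ^ (2 * (γ * κ₀)))
        ≤ 2 * C₀ * ((2 * C₁) ^ (2 * κ₀) * (4 ^ (γ * κ₀) * ((k : ℝ) + 2) ^ (4 * (γ * κ₀)))) := by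
          rw [← hc]; gcongr
      _ ≤ 2 * C₀ * ((2 * C₁) ^ (2 * κ₀) * (4 ^ (γ * κ₀) * (2 * (16 * (γ * κ₀)) ^ (4 * (γ * κ₀)) * (4 / 3 : ℝ) ^ k))) := by
          gcongr
      _ = (4 / 3 : ℝ) ^ k * A₀ := by rw [hA₀]; ring
  -- choose `N` with `(3/4)^N L ≤ A₀` and set `W = A₀`
  obtain ⟨N, hN⟩ : ∃ N : ℕ, (3 / 4 : ℝ) ^ N * L ≤ A₀ := by
    rcases le_or_gt L A₀ with h | h
    · exact ⟨0, by simpa using h⟩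
    · have hLpos : 0 < L := hA₀pos.trans h
      obtain ⟨N, hN⟩ := exists_pow_lt_of_lt_one (div_pos hA₀pos hLpos) (by norm_num : (3 / 4 : ℝ) < 1)
      exact ⟨N, by rw [lt_div_iff₀ hLpos] at hN; exact hN.le⟩
  -- downward induction: `log f ≤ (4/3)^k A₀ · (something ≥ 1)` on `S θ_k`; we carry `W = max A₀ ((3/4)^N L)`
  set W : ℝ := max A₀ ((3 / 4 : ℝ) ^ N * L) with hW
  have hWA : W = A₀ := by rw [hW]; exact max_eq_left hN
  have hP : ∀ j : ℕ, j ≤ N → ∀ x ∈ S (θs (N - j)), Real.log (f x) ≤ (4 / 3 : ℝ) ^ (N - j) * W := by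
    intro j
    induction j with
    | zero =>
        intro _ x hx
        simp only [Nat.sub_zero]
        have h1 : Real.log (f x) ≤ L := hL x (hS (hθle1 N) hx)
        have h2 : L ≤ (4 / 3 : ℝ) ^ N * W := by
          have h3 : (3 / 4 : ℝ) ^ N * L ≤ W := le_max_right _ _
          have h4 : (4 / 3 : ℝ) ^ N * ((3 / 4 : ℝ) ^ N * L) = L := by
            rw [← mul_assoc, ← mul_pow]; norm_num
          rw [← h4]
          exact mul_le_mul_of_nonneg_left h3 (by positivity)
        exact h1.trans h2
    | succ j ih =>
        intro hj x hx
        have hj' : j ≤ N := by omega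
        set k : ℕ := N - (j + 1) with hk
        have hk1 : N - j = k + 1 := by omega
        have ihk : ∀ z ∈ S (θs (k + 1)), Real.log (f z) ≤ (4 / 3 : ℝ) ^ (k + 1) * W := by
          rw [← hk1]; exact ih hj'
        -- the dichotomy at the pair `(θ_k, θ_{k+1})` with `Φ = (4/3)^{k+1} W`
        by_cases hcase : 2 * C₀ * (2 * C₁ / (θs (k + 1) - θs k) ^ γ) ^ (2 * κ₀) < (4 / 3 : ℝ) ^ (k + 1) * W
        · have h := bombieriGiusti_step hS hSm hV0 hVt hf hfpos hC₀ hC₀p hC₁ hγ.le hκ₀ hA hB (hθhalf k) (hθlt k)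
            (hθle1 (k + 1)) ihk hcase x hx
          refine h.trans (le_of_eq ?_)
          rw [pow_succ]; ring
        · rw [not_lt] at hcase
          have h1 : Real.log (f x) ≤ (4 / 3 : ℝ) ^ (k + 1) * W := ihk x (hS (hθlt k).le hx)
          have h2 : (4 / 3 : ℝ) ^ (k + 1) * W ≤ (4 / 3 : ℝ) ^ k * A₀ := hcase.trans (hM₁ k)
          have h3 : (4 / 3 : ℝ) ^ k * A₀ ≤ (4 / 3 : ℝ) ^ k * W :=
            mul_le_mul_of_nonneg_left (le_max_left _ _) (by positivity)
          exact h1.trans (h2.trans h3)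
  intro x hx
  have h := hP N le_rfl x (by rw [Nat.sub_self, hθ0]; exact hx)
  rw [Nat.sub_self, pow_zero, one_mul, hWA] at h
  exact h

end Literature.Analysis.FunctionSpaces

end
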